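import Summits.CriticalPhenomena.PercolationContinuityZ3.Theorems.PercNearOneGluingNoHeavyLowerTailQ7PsiDomReduction
import Literature.Probability.Percolation.KozmaNitzanSeparatingTriple
import HarnessLib

/-!
# Kozma–Nitzan's Question 8 for THREE relays from the POCKET-DESIGNATED dual certificate:
# bookkeeping of the certificate, and the set-avoidance attachment lemma (one of its two `x`-pieces)

Support file (`--supports stmt-CriticalPhenomena-4575`, closed), prover `prim-lf-2` (gen 16).  No definitions, no named
facts, no sorries; standard axioms.  Memo `prim-lf-2/POCKET-CERT-gen16.md`.

SETTING.  One finite weighted graph (`μ = prodBernoulli w`), an observer `o`, strong relays `x, y`, a weak relay `z`, and a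
POCKET EVENT `Dp` — in the application `Dp = {o ↮ x} ∩ {o ↮ y} ∩ {o ↮ z}` (Kozma–Nitzan's Question 8: the designated relay
minimises `μ(a ↔ b, o ↮ A)`), but the bookkeeping below holds for every event `Dp`.  Write `J = {o↔x} ∪ {o↔y}`,
`J' = J ∩ {o↮z}` (the disjoint union of the observer worlds `W1 = {x↔o,x↮y,x↮z}`, `W2 = {y↔o,y↮x,y↮z}`,
`W3 = {x↔o,x↔y,x↮z}`), `Dxz = {x↮z}`, `Dyz = {y↮z}`.  The pocket-designated functional statement
  (GΨ₃^D)  `∫_{Dp} F(C z) ≤ ∫_{Dp} F(C x)`, `∫_{Dp} F(C z) ≤ ∫_{Dp} F(C y)`  ⟹  `∫_J F(C z) ≤ ∫_J F(C o)`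
(every monotone cluster property `F`; at `F = 1{b ∈ ·}` and `Dp = {o↮A}` it is Question 8 for `A = {x,y,z}`) is, by Farkas,
the existence of `λ, μ ≥ 0` with `Ψ − λ·Dx^D − μ·Dy^D ≥ 0` on all up-sets; prim-lf-2's exact census (gen 16: ≈ 10⁴ graphs,
`n ≤ 8`, five pocket families) finds it always feasible, certified by ONE explicit point — the census certificate of the
tree's (GΨ₃) (`Q7Psi.opart_of_halves`, `gpsi_three_of_dom`) with every `x`-side reference mass conditioned on the pocket:
`t_D = a·μ(Dp∩E2)/(a·μ(Dp∩E2) + b·μ(Dp∩E1))`, `λ_D = (a + t_D d)/μ(Dp ∩ Dxz)`, `μ_D = (b + (1−t_D)d)/μ(Dp ∩ Dyz)`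
(`a, b, d` the masses of `W1, W2, W3`; `E1 = {x↮y,x↮z}`, `E2 = {y↮x,y↮z}`), and split into three one-cluster parts each of
which holds separately in the census:
  (P1*D) `λ_D ∫_{Dp ∩ Dxz} G(C x) ≤ ∫_{W1} G(C x) + t_D ∫_{W3} G(C x)`,  (P2*D) symmetric,
  (Z*D)  `∫_{J'} F(C z) ≤ λ_D ∫_{Dp ∩ Dxz} F(C z) + μ_D ∫_{Dp ∩ Dyz} F(C z)`.
THIS FILE (pure bookkeeping; the pieces are in the companion `…KnQuestion8PocketPieces.lean`):
* `PocketCert.opart_of_pocketHalves` — (P1*D) + (P2*D) ⟹ the observer part (O*D), for ARBITRARY left-hand sides;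
* `PocketCert.gpsi_three_pocket_of_dom` — (O*D) + (Z*D) + the two pocket comparisons ⟹ the conclusion of (GΨ₃^D), for every
  event `Dp`, every `F`, every `λ, μ ≥ 0` (mirror of `Q7Psi.gpsi_three_of_dom`);
* `PocketCert.block41_three_of_pocketCert` — `F = 1{b ∈ ·}`: the pre-FKG inequality (41)
  `μ({z↔b} ∩ {o↔A}) ≤ μ({o↔b} ∩ {o↔A})`, `A = {x,y,z}`, from (O*D), (Z*D) in event form and the pocket designation
  `μ(z↔b, Dp) ≤ μ(x↔b, Dp), μ(y↔b, Dp)` — with `Dp = {o↮A}` this is KN's Question 8 at `|A| = 3` CONDITIONAL on the two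
  certificate halves (the tree has `|A| ≤ 2` unconditionally: `KnQ8.knQuestion8_of_card_le_two`);
Companion file: (P1*D) from its two `x`-pieces (BHK-D), (P1**-D) (`PocketCert.p1star_pocket_of_pieces`) and the piece
(BHK-D) proved for the Question-8 pocket (`PocketCert.attach_of_setAvoid`).  What remains for Question 8 at `|A| = 3`: the
pocket covariance comparison (P1**-D) (`x`- and `y`-side) and the weak-relay part (Z*D) — one-cluster inequalities with 0
violations in the census (memo §3).
[cite: KozmaNitzan2024, Questions 7–8 (§5.5 p. 36), display (41), §5.1 (pp. 31–32)]
[cite: VandenbergHaggstromKahn2005, Thm. 2.1 (p. 9), Thms 1.3–1.5 (pp. 6–8)]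
-/

namespace Summit.CriticalPhenomena.PercolationContinuityZ3.Theorems

open MeasureTheory Set Literature.Probability.LatticeModels Literature.Probability.Percolation
open scoped Classical
open KNPreFKG

noncomputable section

namespace PocketCert

variable {V : Type*} [Fintype V]

/-- **(O*D) from its two halves, arbitrary left-hand sides.**  If `Lx ≤ ∫_{x↔o,x↮y,x↮z} F(C x) + t ∫_{x↔o,x↔y,x↮z} F(C x)`
and `Ly ≤ ∫_{y↔o,y↮x,y↮z} F(C y) + (1−t) ∫_{y↔o,y↔x,y↮z} F(C y)` then `Lx + Ly ≤ ∫_{J'} F(C o)`,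
`J' = ({o↔x} ∪ {o↔y}) ∩ {o↮z}` (the three observer worlds partition `J'`; on them `C o` is `C x`, `C y`, `C x = C y`).
The bookkeeping of `Q7Psi.opart_of_halves`, freed from the shape of the left-hand sides.
[cite: KozmaNitzan2024, §5.1 (pp. 31–32)] -/
theorem opart_of_pocketHalves (w : Sym2 V → unitInterval) (o x y z : V) (F : Set V → ℝ) (t Lx Ly : ℝ)
    (hP1 : Lx ≤
      (∫ ω in openConn x o ∩ {ω | ¬ (openGraph ω).Reachable x y} ∩ {ω | ¬ (openGraph ω).Reachable x z},
          F (openCluster ω x) ∂(prodBernoulli w)) +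
        t * ∫ ω in openConn x o ∩ openConn x y ∩ {ω | ¬ (openGraph ω).Reachable x z},
          F (openCluster ω x) ∂(prodBernoulli w))
    (hP2 : Ly ≤
      (∫ ω in openConn y o ∩ {ω | ¬ (openGraph ω).Reachable y x} ∩ {ω | ¬ (openGraph ω).Reachable y z},
          F (openCluster ω y) ∂(prodBernoulli w)) +
        (1 - t) * ∫ ω in openConn y o ∩ openConn y x ∩ {ω | ¬ (openGraph ω).Reachable y z},
          F (openCluster ω y) ∂(prodBernoulli w)) :
    Lx + Ly ≤ ∫ ω in (openConn o x ∪ openConn o y) ∩ {ω | ¬ (openGraph ω).Reachable o z},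
        F (openCluster ω o) ∂(prodBernoulli w) := by
  classical
  -- `Q7Psi.opart_of_halves` with `λ = μ = 1` applied to the constant integrands would not fit; redo the bookkeeping.
  set μ := prodBernoulli w with hμ
  set S1 : Set (BondConfig V) :=
    openConn x o ∩ {ω | ¬ (openGraph ω).Reachable x y} ∩ {ω | ¬ (openGraph ω).Reachable x z} with hS1
  set S2 : Set (BondConfig V) :=
    openConn y o ∩ {ω | ¬ (openGraph ω).Reachable y x} ∩ {ω | ¬ (openGraph ω).Reachable y z} with hS2
  set S3 : Set (BondConfig V) := openConn x o ∩ openConn x y ∩ {ω | ¬ (openGraph ω).Reachable x z} with hS3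
  set S3' : Set (BondConfig V) := openConn y o ∩ openConn y x ∩ {ω | ¬ (openGraph ω).Reachable y z} with hS3'
  set J' : Set (BondConfig V) := (openConn o x ∪ openConn o y) ∩ {ω | ¬ (openGraph ω).Reachable o z} with hJ'
  have hmeas : ∀ S : Set (BondConfig V), MeasurableSet S := fun _ => MeasurableSet.of_discrete
  have hint : ∀ (g : BondConfig V → ℝ) (S : Set (BondConfig V)), IntegrableOn g S μ :=
    fun g S => (Integrable.of_finite).integrableOn
  have h33 : S3 = S3' := by
    ext ω
    simp only [hS3, hS3', mem_inter_iff, mem_setOf_eq, openConn]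
    constructor
    · rintro ⟨⟨hxo, hxy⟩, hxz⟩
      exact ⟨⟨hxy.symm.trans hxo, hxy.symm⟩, fun hyz => hxz (hxy.trans hyz)⟩
    · rintro ⟨⟨hyo, hyx⟩, hyz⟩
      exact ⟨⟨hyx.symm.trans hyo, hyx.symm⟩, fun hxz => hyz (hyx.trans hxz)⟩
  have hJeq : J' = (S1 ∪ S2) ∪ S3 := by
    ext ω
    simp only [hJ', hS1, hS2, hS3, mem_inter_iff, mem_union, mem_setOf_eq, openConn]
    constructor
    · rintro ⟨hJ, hoz⟩
      by_cases hox : (openGraph ω).Reachable o x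
      · by_cases hxy : (openGraph ω).Reachable x y
        · exact Or.inr ⟨⟨hox.symm, hxy⟩, fun hxz => hoz (hox.trans hxz)⟩
        · exact Or.inl (Or.inl ⟨⟨hox.symm, hxy⟩, fun hxz => hoz (hox.trans hxz)⟩)
      · have hoy : (openGraph ω).Reachable o y := by
          rcases hJ with h | h
          · exact absurd h hox
          · exact h
        refine Or.inl (Or.inr ⟨⟨hoy.symm, fun hyx => hox (hoy.trans hyx)⟩, fun hyz => hoz (hoy.trans hyz)⟩)
    · rintro ((⟨⟨hxo, _⟩, hxz⟩ | ⟨⟨hyo, _⟩, hyz⟩) | ⟨⟨hxo, _⟩, hxz⟩)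
      · exact ⟨Or.inl hxo.symm, fun hoz => hxz (hxo.trans hoz)⟩
      · exact ⟨Or.inr hyo.symm, fun hoz => hyz (hyo.trans hoz)⟩
      · exact ⟨Or.inl hxo.symm, fun hoz => hxz (hxo.trans hoz)⟩
  have hd12 : Disjoint S1 S2 := by
    rw [Set.disjoint_left]
    rintro ω ⟨⟨hxo, hxy⟩, _⟩ ⟨⟨hyo, _⟩, _⟩
    exact hxy (SimpleGraph.Reachable.trans hxo (SimpleGraph.Reachable.symm hyo))
  have hd123 : Disjoint (S1 ∪ S2) S3 := by
    rw [Set.disjoint_left]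
    rintro ω (⟨⟨_, hxy⟩, _⟩ | ⟨⟨_, hyx⟩, _⟩) ⟨⟨_, hxy'⟩, _⟩
    · exact hxy hxy'
    · exact hyx (SimpleGraph.Reachable.symm hxy')
  have hsplit : ∫ ω in J', F (openCluster ω o) ∂μ =
      ∫ ω in S1, F (openCluster ω o) ∂μ + ∫ ω in S2, F (openCluster ω o) ∂μ +
        ∫ ω in S3, F (openCluster ω o) ∂μ := by
    rw [hJeq, setIntegral_union hd123 (hmeas _) (hint _ _) (hint _ _),
      setIntegral_union hd12 (hmeas _) (hint _ _) (hint _ _)]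
  have e1 : ∫ ω in S1, F (openCluster ω o) ∂μ = ∫ ω in S1, F (openCluster ω x) ∂μ := by
    refine setIntegral_congr_fun (hmeas _) fun ω hω => ?_
    rw [openCluster_eq_of_reachable (show (openGraph ω).Reachable x o from hω.1.1)]
  have e2 : ∫ ω in S2, F (openCluster ω o) ∂μ = ∫ ω in S2, F (openCluster ω y) ∂μ := by
    refine setIntegral_congr_fun (hmeas _) fun ω hω => ?_
    rw [openCluster_eq_of_reachable (show (openGraph ω).Reachable y o from hω.1.1)]
  have e3x : ∫ ω in S3, F (openCluster ω o) ∂μ = ∫ ω in S3, F (openCluster ω x) ∂μ := by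
    refine setIntegral_congr_fun (hmeas _) fun ω hω => ?_
    rw [openCluster_eq_of_reachable (show (openGraph ω).Reachable x o from hω.1.1)]
  have e3y : ∫ ω in S3', F (openCluster ω o) ∂μ = ∫ ω in S3', F (openCluster ω y) ∂μ := by
    refine setIntegral_congr_fun (hmeas _) fun ω hω => ?_
    rw [openCluster_eq_of_reachable (show (openGraph ω).Reachable y o from hω.1.1)]
  have e3 : ∫ ω in S3, F (openCluster ω o) ∂μ =
      t * ∫ ω in S3, F (openCluster ω x) ∂μ + (1 - t) * ∫ ω in S3', F (openCluster ω y) ∂μ := by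
    rw [← e3y, ← h33, ← e3x]
    ring
  rw [hsplit, e1, e2, e3]
  linarith

/-- **Restricting a pocket comparison to `{x ↮ z}`.**  For every event `Dp`:
`∫_{Dp} F(C z) ≤ ∫_{Dp} F(C x)` gives `∫_{Dp ∩ {x↮z}} F(C z) ≤ ∫_{Dp ∩ {x↮z}} F(C x)` (on `{x ↔ z}` the two clusters
coincide). [cite: KozmaNitzan2024, §5.1 (pp. 31–32)] -/
theorem pocket_comparison_restrict (w : Sym2 V → unitInterval) (x z : V) (F : Set V → ℝ) (Dp : Set (BondConfig V))
    (hx : ∫ ω in Dp, F (openCluster ω z) ∂(prodBernoulli w) ≤ ∫ ω in Dp, F (openCluster ω x) ∂(prodBernoulli w)) :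
    ∫ ω in Dp ∩ {ω | ¬ (openGraph ω).Reachable x z}, F (openCluster ω z) ∂(prodBernoulli w) ≤
      ∫ ω in Dp ∩ {ω | ¬ (openGraph ω).Reachable x z}, F (openCluster ω x) ∂(prodBernoulli w) := by
  classical
  set μ := prodBernoulli w with hμ
  set Dxz : Set (BondConfig V) := {ω | ¬ (openGraph ω).Reachable x z} with hDxz
  have hmeas : ∀ S : Set (BondConfig V), MeasurableSet S := fun _ => MeasurableSet.of_discrete
  have hint : ∀ (g : BondConfig V → ℝ) (S : Set (BondConfig V)), IntegrableOn g S μ :=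
    fun g S => (Integrable.of_finite).integrableOn
  have ex := integral_inter_add_sdiff (hmeas Dxz) (hint (fun ω => F (openCluster ω x)) Dp)
  have ez := integral_inter_add_sdiff (hmeas Dxz) (hint (fun ω => F (openCluster ω z)) Dp)
  have ec : ∫ ω in Dp \ Dxz, F (openCluster ω z) ∂μ = ∫ ω in Dp \ Dxz, F (openCluster ω x) ∂μ := by
    refine setIntegral_congr_fun ((hmeas Dp).diff (hmeas Dxz)) fun ω hω => ?_
    have hr : (openGraph ω).Reachable x z := by
      by_contra hc
      exact hω.2 hc
    rw [openCluster_eq_of_reachable hr]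
  have hx' : ∫ ω in Dp, F (openCluster ω z) ∂μ ≤ ∫ ω in Dp, F (openCluster ω x) ∂μ := hx
  linarith

/-- **The conclusion of (GΨ₃^D) from the pocket-designated dual certificate.**  For every event `Dp` (the pocket), every
`F`, every `λ, μ ≥ 0`: if the observer part (O*D)
`λ ∫_{Dp ∩ {x↮z}} F(C x) + μ ∫_{Dp ∩ {y↮z}} F(C y) ≤ ∫_{J'} F(C o)` and the weak-relay part (Z*D)
`∫_{J'} F(C z) ≤ λ ∫_{Dp ∩ {x↮z}} F(C z) + μ ∫_{Dp ∩ {y↮z}} F(C z)` hold (`J' = ({o↔x} ∪ {o↔y}) ∩ {o↮z}`), then the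
pocket comparisons `∫_{Dp} F(C z) ≤ ∫_{Dp} F(C x)`, `∫_{Dp} F(C z) ≤ ∫_{Dp} F(C y)` give
`∫_{o↔x ∪ o↔y} F(C z) ≤ ∫_{o↔x ∪ o↔y} F(C o)`.  (`Dp = univ` is `Q7Psi.gpsi_three_of_dom`.)
[cite: KozmaNitzan2024, §5.1 (pp. 31–32), Questions 7–8 (p. 36)] -/
theorem gpsi_three_pocket_of_dom (w : Sym2 V → unitInterval) (o x y z : V) (F : Set V → ℝ)
    (Dp : Set (BondConfig V)) (lam mu : ℝ) (hlam : 0 ≤ lam) (hmu : 0 ≤ mu)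
    (hO : lam * (∫ ω in Dp ∩ {ω | ¬ (openGraph ω).Reachable x z}, F (openCluster ω x) ∂(prodBernoulli w)) +
        mu * (∫ ω in Dp ∩ {ω | ¬ (openGraph ω).Reachable y z}, F (openCluster ω y) ∂(prodBernoulli w)) ≤
      ∫ ω in (openConn o x ∪ openConn o y) ∩ {ω | ¬ (openGraph ω).Reachable o z},
        F (openCluster ω o) ∂(prodBernoulli w))
    (hZ : ∫ ω in (openConn o x ∪ openConn o y) ∩ {ω | ¬ (openGraph ω).Reachable o z},
        F (openCluster ω z) ∂(prodBernoulli w) ≤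
      lam * (∫ ω in Dp ∩ {ω | ¬ (openGraph ω).Reachable x z}, F (openCluster ω z) ∂(prodBernoulli w)) +
        mu * (∫ ω in Dp ∩ {ω | ¬ (openGraph ω).Reachable y z}, F (openCluster ω z) ∂(prodBernoulli w)))
    (hx : ∫ ω in Dp, F (openCluster ω z) ∂(prodBernoulli w) ≤ ∫ ω in Dp, F (openCluster ω x) ∂(prodBernoulli w))
    (hy : ∫ ω in Dp, F (openCluster ω z) ∂(prodBernoulli w) ≤ ∫ ω in Dp, F (openCluster ω y) ∂(prodBernoulli w)) :
    ∫ ω in (openConn o x ∪ openConn o y), F (openCluster ω z) ∂(prodBernoulli w) ≤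
      ∫ ω in (openConn o x ∪ openConn o y), F (openCluster ω o) ∂(prodBernoulli w) := by
  classical
  set μ := prodBernoulli w with hμ
  set J : Set (BondConfig V) := openConn o x ∪ openConn o y with hJ
  set Doz : Set (BondConfig V) := {ω | ¬ (openGraph ω).Reachable o z} with hDoz
  set Dxz : Set (BondConfig V) := {ω | ¬ (openGraph ω).Reachable x z} with hDxz
  set Dyz : Set (BondConfig V) := {ω | ¬ (openGraph ω).Reachable y z} with hDyz
  have hmeas : ∀ S : Set (BondConfig V), MeasurableSet S := fun _ => MeasurableSet.of_discrete
  have hint : ∀ (g : BondConfig V → ℝ) (S : Set (BondConfig V)), IntegrableOn g S μ :=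
    fun g S => (Integrable.of_finite).integrableOn
  have hx' : ∫ ω in Dp ∩ Dxz, F (openCluster ω z) ∂μ ≤ ∫ ω in Dp ∩ Dxz, F (openCluster ω x) ∂μ :=
    pocket_comparison_restrict w x z F Dp hx
  have hy' : ∫ ω in Dp ∩ Dyz, F (openCluster ω z) ∂μ ≤ ∫ ω in Dp ∩ Dyz, F (openCluster ω y) ∂μ :=
    pocket_comparison_restrict w y z F Dp hy
  have hJ' : ∫ ω in J ∩ Doz, F (openCluster ω z) ∂μ ≤ ∫ ω in J ∩ Doz, F (openCluster ω o) ∂μ := by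
    have h1 := mul_le_mul_of_nonneg_left (sub_nonneg.2 hx') hlam
    have h2 := mul_le_mul_of_nonneg_left (sub_nonneg.2 hy') hmu
    have hO' : lam * (∫ ω in Dp ∩ Dxz, F (openCluster ω x) ∂μ) + mu * (∫ ω in Dp ∩ Dyz, F (openCluster ω y) ∂μ) ≤
        ∫ ω in J ∩ Doz, F (openCluster ω o) ∂μ := hO
    have hZ' : ∫ ω in J ∩ Doz, F (openCluster ω z) ∂μ ≤
        lam * (∫ ω in Dp ∩ Dxz, F (openCluster ω z) ∂μ) + mu * (∫ ω in Dp ∩ Dyz, F (openCluster ω z) ∂μ) := hZ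
    nlinarith
  have hc : ∫ ω in J \ Doz, F (openCluster ω z) ∂μ = ∫ ω in J \ Doz, F (openCluster ω o) ∂μ := by
    refine setIntegral_congr_fun ((hmeas J).diff (hmeas Doz)) fun ω hω => ?_
    have hr : (openGraph ω).Reachable o z := by
      by_contra hc
      exact hω.2 hc
    rw [openCluster_eq_of_reachable hr]
  rw [← integral_inter_add_sdiff (hmeas Doz) (hint _ J), ← integral_inter_add_sdiff (hmeas Doz) (hint _ J), hc]
  linarith

omit [Fintype V] in
/-- The indicator cluster property `1{b ∈ ·}` evaluated on `C v` is the indicator of the event `{v ↔ b}`. [folklore] -/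
theorem indicator_openCluster_eq (b v : V) (ω : BondConfig V) :
    (openCluster ω v).indicator (1 : V → ℝ) b = (openConn v b : Set (BondConfig V)).indicator 1 ω := by
  by_cases h : (openGraph ω).Reachable v b
  · rw [indicator_of_mem (show b ∈ openCluster ω v from h), indicator_of_mem (show ω ∈ openConn v b from h)]
    simp
  · rw [indicator_of_notMem (show b ∉ openCluster ω v from h), indicator_of_notMem (show ω ∉ openConn v b from h)]

/-- Set integrals of `1{b ∈ C v}` are measures of `{v ↔ b}`-intersections. [folklore] -/
theorem setIntegral_indicator_openCluster (μ' : Measure (BondConfig V)) [IsFiniteMeasure μ'] (b v : V)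
    (S : Set (BondConfig V)) :
    ∫ ω in S, (openCluster ω v).indicator (1 : V → ℝ) b ∂μ' = μ'.real (S ∩ openConn v b) := by
  simp_rw [indicator_openCluster_eq b v]
  exact setIntegral_indicator_one_eq μ' S _

/-- **The pre-FKG inequality (41) for three relays from the pocket certificate (event form).**  Observer `o`, relays
`x, y, z`, target `b`, pocket event `Dp`, `λ, μ ≥ 0`, `J' = ({o↔x} ∪ {o↔y}) ∩ {o↮z}`.  If
(O*D) `λ·μ(Dp ∩ {x↮z} ∩ {x↔b}) + μ·μ(Dp ∩ {y↮z} ∩ {y↔b}) ≤ μ(J' ∩ {o↔b})`,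
(Z*D) `μ(J' ∩ {z↔b}) ≤ λ·μ(Dp ∩ {x↮z} ∩ {z↔b}) + μ·μ(Dp ∩ {y↮z} ∩ {z↔b})`, and the relay `z` is POCKET-DESIGNATED,
`μ(Dp ∩ {z↔b}) ≤ μ(Dp ∩ {x↔b})`, `μ(Dp ∩ {z↔b}) ≤ μ(Dp ∩ {y↔b})`, then
`μ({z↔b} ∩ {o↔A}) ≤ μ({o↔b} ∩ {o↔A})`, `{o↔A} = {o↔x} ∪ {o↔y} ∪ {o↔z}`.  With `Dp = {o↮x} ∩ {o↮y} ∩ {o↮z}` the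
designation is Kozma–Nitzan's Question 8 (arXiv:2401.12397 §5.5) for `A = {x,y,z}`; the two certificate halves are the
conjectural inputs (prim-lf-2 gen-16 census: 0 violations at the explicit point `(t_D, λ_D, μ_D)` of the file header).
[cite: KozmaNitzan2024, Question 8 (§5.5 p. 36), display (41)] -/
theorem block41_three_of_pocketCert (w : Sym2 V → unitInterval) (o b x y z : V) (Dp : Set (BondConfig V))
    (lam mu : ℝ) (hlam : 0 ≤ lam) (hmu : 0 ≤ mu)
    (hO : lam * (prodBernoulli w).real (Dp ∩ {ω | ¬ (openGraph ω).Reachable x z} ∩ openConn x b) +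
        mu * (prodBernoulli w).real (Dp ∩ {ω | ¬ (openGraph ω).Reachable y z} ∩ openConn y b) ≤
      (prodBernoulli w).real ((openConn o x ∪ openConn o y) ∩ {ω | ¬ (openGraph ω).Reachable o z} ∩ openConn o b))
    (hZ : (prodBernoulli w).real ((openConn o x ∪ openConn o y) ∩ {ω | ¬ (openGraph ω).Reachable o z} ∩ openConn z b) ≤
      lam * (prodBernoulli w).real (Dp ∩ {ω | ¬ (openGraph ω).Reachable x z} ∩ openConn z b) +
        mu * (prodBernoulli w).real (Dp ∩ {ω | ¬ (openGraph ω).Reachable y z} ∩ openConn z b))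
    (hx : (prodBernoulli w).real (Dp ∩ openConn z b) ≤ (prodBernoulli w).real (Dp ∩ openConn x b))
    (hy : (prodBernoulli w).real (Dp ∩ openConn z b) ≤ (prodBernoulli w).real (Dp ∩ openConn y b)) :
    (prodBernoulli w).real (openConn z b ∩ (openConn o x ∪ openConn o y ∪ openConn o z)) ≤
      (prodBernoulli w).real (openConn o b ∩ (openConn o x ∪ openConn o y ∪ openConn o z)) := by
  classical
  set μ := prodBernoulli w with hμ
  have hmeas : ∀ S : Set (BondConfig V), MeasurableSet S := fun _ => MeasurableSet.of_discrete
  set F : Set V → ℝ := fun T => T.indicator (1 : V → ℝ) b with hF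
  have hI : ∀ (v : V) (S : Set (BondConfig V)), ∫ ω in S, F (openCluster ω v) ∂μ = μ.real (S ∩ openConn v b) :=
    fun v S => setIntegral_indicator_openCluster μ b v S
  -- (GΨ₃^D) at `F = 1{b ∈ ·}`
  have key := gpsi_three_pocket_of_dom w o x y z F Dp lam mu hlam hmu
    (by rw [hI, hI, hI]; exact hO) (by rw [hI, hI, hI]; exact hZ) (by rw [hI, hI]; exact hx) (by rw [hI, hI]; exact hy)
  rw [hI, hI] at key
  -- from `J = {o↔x} ∪ {o↔y}` to `{o↔A}`: on `{o↔z} ∖ J` both events coincide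
  set J : Set (BondConfig V) := openConn o x ∪ openConn o y with hJ
  have hsplit : ∀ X : Set (BondConfig V), μ.real (X ∩ (J ∪ openConn o z)) =
      μ.real (J ∩ X) + μ.real (X ∩ openConn o z ∩ Jᶜ) := by
    intro X
    have hdj : Disjoint (J ∩ X) (X ∩ openConn o z ∩ Jᶜ) := by
      rw [Set.disjoint_left]
      rintro ω ⟨h, -⟩ ⟨-, hn⟩
      exact hn h
    rw [← measureReal_union hdj (hmeas _)]
    congr 1
    ext ω
    simp only [mem_inter_iff, mem_union, mem_compl_iff]
    tauto
  have hz_eq : openConn z b ∩ openConn o z ∩ Jᶜ = openConn o b ∩ openConn o z ∩ Jᶜ := by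
    ext ω
    simp only [mem_inter_iff, mem_compl_iff, openConn, mem_setOf_eq]
    constructor
    · rintro ⟨⟨hzb, hoz⟩, hn⟩
      exact ⟨⟨hoz.trans hzb, hoz⟩, hn⟩
    · rintro ⟨⟨hob, hoz⟩, hn⟩
      exact ⟨⟨hoz.symm.trans hob, hoz⟩, hn⟩
  have hA : openConn o x ∪ openConn o y ∪ openConn o z = J ∪ openConn o z := rfl
  rw [hA, hsplit, hsplit, hz_eq]
  linarith

end PocketCert

end

end Summit.CriticalPhenomena.PercolationContinuityZ3.Theorems
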